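import Summits.FinalStateConjecture.FinalStateConjecture.Theorems.ClusterCompletenessOmegaLimitMultiKerrLimitIsMetric
import HarnessLib

/-!
# Route ClusterCompleteness · crux `OmegaLimitMultiKerr` — the EXACT nondegeneracy margin
# `√(1 + h²) − h` of a null rank-one deformation of `η`; the sharp at-rest anchor threshold

Structure lemmas for the crux stmt-FinalStateConjecture-14664
(`ClusterCompleteness.OmegaLimitMultiKerr`), line `Sketch`, lead gen 4, registered stub
`quarter_mul_norm_le_norm_kerrBilin` (closed form).

The recur-disjunct of the crux anchors every hole chart at all late times by
`‖Ψ^* 𝐠(x) − g_{M,a,Λ,c}(x)‖ ≤ 1/4` (operator norm, Euclidean coordinates of `E4`); this certifies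
nondegeneracy of the chart metric at `x` when the MARGIN of `B = g_{M,a,Λ,c}(x)` — the best `m`
with `m‖v‖ ≤ ‖B(v, ·)‖` — exceeds `1/4` (`isInvertible_add_of_norm_lt_margin`, `…LimitIsMetric`;
crude margin `(‖Λ‖²(1 + 4|H|))⁻¹` in `SublinearIsFree.Slaving`, at-rest soundness for
`a² ≤ (8/9)M²` in `…RestAnchor`, a boosted witness with margin `≤ 1/8` in `…AnchorMargin`). Here
the margin is computed EXACTLY. For `B(v, w) = η(v, w) + h ℓ(v)ℓ(w)`, `ℓ = η(n, ·)`, `n` `η`-NULL,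
`h ≥ 0`, the Gram matrix in an orthonormal basis `(e₀, ℓ⃗/|ℓ⃗|, ⊥, ⊥)` is
`[[−1 + h', h'], [h', 1 + h']] ⊕ 1₂`, `h' = h(n⁰)²`, eigenvalues `h' ± √(1 + h'²), 1, 1`: the
margin is `μ(h') = √(1 + h'²) − h'` (`mul_norm_le_norm_of_nullRankOne`, testing `B(v, ·)` on its
Riesz vector; sharp by an explicit eigenvector, `exists_norm_le_mul_norm_of_nullRankOne`); `μ` is
antitone (`sqrt_one_add_sq_sub_le`), `μ(h') > 1/4 ⇔ h' < 15/8`. Consequences: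
* KERR AT REST: the margin of `g_{M,a}(y) = η + 2Hℓ ⊗ ℓ` is exactly `μ(2H(y))` wherever `r > 0`,
  `0 ≤ M` (`mul_norm_le_norm_kerrBilin`, `exists_norm_kerrBilin_le_mul_norm`), `≥ μ(2M/r)`;
* `quarter_mul_norm_le_norm_kerrBilin` (MAIN, registered): for `0 < M`, `a² < (224/225)M²` and
  `x ∈ Kerr.exterior M a`, `(1/4)‖v‖ ≤ ‖g_{M,a}(x)(v, ·)‖` (`r > r₊ > 16M/15`, `2H ≤ 2M/r < 15/8`);
  the margin is even `> 1/4`, so `G + g_{M,a}(x)` is invertible for all `‖G‖ ≤ 1/4`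
  (`isInvertible_add_kerrBilin_of_norm_le_quarter_of_sq_lt`) — sharpens `…RestAnchor`'s
  `a² ≤ (8/9)M²` to the optimal `a² < (224/225)M²` (`|a| < 0.9978M`);
* `exists_norm_kerrBilin_lt_quarter_mul_norm`: for `(224/225)M² < a² < M²` some exterior
  (equatorial, near-horizon) `x` and `v ≠ 0` have `‖g_{M,a}(x)(v, ·)‖ < (1/4)‖v‖` — even AT REST
  near-extremal frame dragging defeats the absolute `1/4` anchor (cf. `…AnchorMargin`);
* BOOSTED: the margin of `g_{M,a,Λ,c}(x)` is exactly `μ(2H(y)D²)`, `y = Λ⁻¹(x − c)`,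
  `D = ℓ_y(Λ⁻¹e₀) = −(Λℓ♯)⁰` the Doppler factor (`mul_norm_le_norm_boostedKerrBilin_exact`,
  `exists_norm_boostedKerrBilin_le_mul_norm`): the `1/4` anchor is sound at `x` iff
  `2H(y)D² < 15/8` — at the Schwarzschild horizon iff `D² < 15/8`, i.e. recession speed `β < 7/23`.

Everything is proved; Mathlib + landed `Literature` / `Theorems` files only, no definitions.
References: Kerr–Schild 1965, §2–§3 [KerrSchild1965]; O'Neill 1983, Ch. 3, Ch. 9 [ONeill1983]. -/

-- every `Summit.FinalStateConjecture.FinalStateConjecture.…` name repeats the summit = sub-problem segment (D-0017 layout)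
set_option linter.dupNamespace false

noncomputable section

namespace Summit.FinalStateConjecture.FinalStateConjecture.Theorems.ClusterCompleteness

open Literature.Geometry.Lorentzian

/-- `η(v, w) = −v⁰w⁰ + v¹w¹ + v²w² + v³w³` (O'Neill 1983, Ch. 3, p. 55). [folklore] -/
theorem minkowski_bilin_apply_four (v w : E4) :
    Minkowski.bilin v w = -(v 0 * w 0) + (v 1 * w 1 + v 2 * w 2 + v 3 * w 3) := by
  rw [Minkowski.bilin_apply, Fin.sum_univ_three]
  rfl

/-- `⟪v, w⟫ = Σ_μ v^μ w^μ` for the Euclidean inner product of `E4`. [folklore] -/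
theorem inner_four (v w : E4) : inner ℝ v w = v 0 * w 0 + v 1 * w 1 + v 2 * w 2 + v 3 * w 3 := by
  simp [PiLp.inner_apply, Fin.sum_univ_four]
  ring

/-- Nullity in components: `η(n, n) = 0` gives `(n⁰)² = (n¹)² + (n²)² + (n³)²`, i.e. the covector
`ℓ = η(n, ·) = (−n⁰, n¹, n², n³)` has `ℓ₀² = |ℓ⃗|²` (Kerr–Schild 1965, §2). [folklore] -/
theorem sq_apply_zero_eq_of_null {n : E4} (hn : Minkowski.bilin n n = 0) :
    n 0 ^ 2 = n 1 ^ 2 + n 2 ^ 2 + n 3 ^ 2 := by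
  rw [minkowski_bilin_apply_four] at hn
  linear_combination -hn

/-- **Bessel for the null pair**: with `p = ℓ(v) = η(n, v)`, `q = ⟪n, v⟫` and `η(n, n) = 0`,
`p² + q² = 2(n⁰v⁰)² + 2⟪n⃗, v⃗⟫² ≤ 2(n⁰)²‖v‖²` (Cauchy–Schwarz, `|n⃗|² = (n⁰)²`). [folklore] -/
theorem sq_add_sq_le_of_null {n : E4} (hn : Minkowski.bilin n n = 0) (v : E4) :
    (-(n 0 * v 0) + (n 1 * v 1 + n 2 * v 2 + n 3 * v 3)) ^ 2 +
      (n 0 * v 0 + (n 1 * v 1 + n 2 * v 2 + n 3 * v 3)) ^ 2 ≤ 2 * n 0 ^ 2 * ‖v‖ ^ 2 := by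
  have hn' := sq_apply_zero_eq_of_null hn
  rw [EuclideanSpace.real_norm_sq_eq, Fin.sum_univ_four]
  nlinarith [sq_nonneg (n 1 * v 2 - n 2 * v 1), sq_nonneg (n 1 * v 3 - n 3 * v 1),
    sq_nonneg (n 2 * v 3 - n 3 * v 2)]

/-- **The real-arithmetic heart of the margin bound**: for `h, s ≥ 0`, `s² = 1 + (hκ)²` and
`p² + q² ≤ 2κN`, `(s − hκ)²N ≤ N + 2hpq + 2κh²p²` — the difference is
`h(s − hκ)[(2κN − p² − q²) + ((s + hκ)p + q)²]` (as `(s + hκ)(s − hκ) = 1`), `hκ ≤ s`. [folklore] -/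
theorem sub_sq_mul_le_of_sq_add_sq_le {h κ s N p q : ℝ} (hh : 0 ≤ h) (hs : 0 ≤ s)
    (hs2 : s ^ 2 = 1 + (h * κ) ^ 2) (hpq : p ^ 2 + q ^ 2 ≤ 2 * κ * N) :
    (s - h * κ) ^ 2 * N ≤ N + 2 * h * p * q + 2 * κ * h ^ 2 * p ^ 2 := by
  have hsk : h * κ ≤ s := le_of_sq_le_sq (by rw [hs2]; linarith [sq_nonneg (h * κ)]) hs
  have key : N + 2 * h * p * q + 2 * κ * h ^ 2 * p ^ 2 - (s - h * κ) ^ 2 * N =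
      h * (s - h * κ) * (2 * κ * N - (p ^ 2 + q ^ 2)) +
        h * (s - h * κ) * ((s + h * κ) * p + q) ^ 2 := by
    linear_combination (-(N + 2 * h * p * q + h * (s + h * κ) * p ^ 2)) * hs2
  nlinarith [mul_nonneg (mul_nonneg hh (sub_nonneg.2 hsk)) (sub_nonneg.2 hpq),
    mul_nonneg (mul_nonneg hh (sub_nonneg.2 hsk)) (sq_nonneg ((s + h * κ) * p + q))]

/-- **Exact margin of a null rank-one deformation of `η`, lower bound.** Let
`B(v, w) = η(v, w) + h η(n, v)η(n, w)` on `E4` with `η(n, n) = 0` (the covector `ℓ = η(n, ·)` is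
`η`-null) and `h ≥ 0`. Then `(√(1 + h'²) − h')‖v‖ ≤ ‖B(v, ·)‖` for all `v`, `h' = h(n⁰)²`
(Euclidean operator norm; Gram matrix `[[−1 + h', h'], [h', 1 + h']] ⊕ 1₂` in an orthonormal basis
`(e₀, ℓ⃗/|ℓ⃗|, ⊥, ⊥)`). Proof: the Riesz vector `w = θv + hℓ(v)θn` of `B(v, ·)` (`θ` the time
flip) gives `B(v, w) = ‖w‖² ≤ ‖B(v, ·)‖‖w‖` and `‖w‖² = ‖v‖² + 2hpq + 2(n⁰)²h²p² ≥ μ²‖v‖²`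
(`sub_sq_mul_le_of_sq_add_sq_le`). Quantitative Kerr–Schild 1965, §2. [cite: KerrSchild1965, §2] -/
theorem mul_norm_le_norm_of_nullRankOne {B : E4 →L[ℝ] E4 →L[ℝ] ℝ} {n : E4} {h : ℝ}
    (hB : ∀ v w, B v w = Minkowski.bilin v w + h * (Minkowski.bilin n v * Minkowski.bilin n w))
    (hn : Minkowski.bilin n n = 0) (hh : 0 ≤ h) (v : E4) :
    (√(1 + (h * n 0 ^ 2) ^ 2) - h * n 0 ^ 2) * ‖v‖ ≤ ‖B v‖ := by
  set s := √(1 + (h * n 0 ^ 2) ^ 2)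
  have hs2 : s ^ 2 = 1 + (h * n 0 ^ 2) ^ 2 := Real.sq_sqrt (by positivity)
  have hn' := sq_apply_zero_eq_of_null hn
  have hpq := sq_add_sq_le_of_null hn v
  -- `p = ℓ(v) = η(n, v)`, `q = ⟪n, v⟫`; the Riesz vector `w = θv + hp θn` of `B(v, ·)`
  obtain ⟨p, hp⟩ : ∃ p : ℝ, p = -(n 0 * v 0) + (n 1 * v 1 + n 2 * v 2 + n 3 * v 3) := ⟨_, rfl⟩
  obtain ⟨q, hq⟩ : ∃ q : ℝ, q = n 0 * v 0 + (n 1 * v 1 + n 2 * v 2 + n 3 * v 3) := ⟨_, rfl⟩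
  rw [← hp, ← hq] at hpq
  obtain ⟨w, hw0, hw1, hw2, hw3⟩ : ∃ w : E4, w 0 = -v 0 - h * p * n 0 ∧ w 1 = v 1 + h * p * n 1 ∧
      w 2 = v 2 + h * p * n 2 ∧ w 3 = v 3 + h * p * n 3 :=
    ⟨WithLp.toLp 2 ![-v 0 - h * p * n 0, v 1 + h * p * n 1, v 2 + h * p * n 2, v 3 + h * p * n 3],
      rfl, rfl, rfl, rfl⟩
  have hww : ‖w‖ ^ 2 = ‖v‖ ^ 2 + 2 * h * p * q + 2 * n 0 ^ 2 * h ^ 2 * p ^ 2 := by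
    rw [EuclideanSpace.real_norm_sq_eq, EuclideanSpace.real_norm_sq_eq, Fin.sum_univ_four,
      Fin.sum_univ_four, hw0, hw1, hw2, hw3, hq]
    linear_combination (-(h ^ 2 * p ^ 2)) * hn'
  have hBvw : B v w = ‖w‖ ^ 2 := by
    rw [hB, EuclideanSpace.real_norm_sq_eq w, Fin.sum_univ_four, minkowski_bilin_apply_four,
      minkowski_bilin_apply_four n w, minkowski_bilin_apply_four n v, ← hp, hw0, hw1, hw2, hw3]
    ring
  -- `‖w‖² = B(v, w) ≤ ‖B(v, ·)‖‖w‖` and `μ²‖v‖² ≤ ‖w‖²`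
  have h1 := (B v).le_opNorm w
  rw [hBvw, Real.norm_eq_abs, abs_of_nonneg (sq_nonneg _)] at h1
  refine le_of_sq_le_sq ?_ (norm_nonneg _)
  calc ((s - h * n 0 ^ 2) * ‖v‖) ^ 2 = (s - h * n 0 ^ 2) ^ 2 * ‖v‖ ^ 2 := by ring
    _ ≤ ‖w‖ ^ 2 := hww ▸ sub_sq_mul_le_of_sq_add_sq_le hh (Real.sqrt_nonneg _) hs2 hpq
    _ ≤ ‖B v‖ ^ 2 := by nlinarith [h1, sq_nonneg (‖w‖ - ‖B v‖)]

/-- **Sharpness: the exact eigenvector.** For `B(v, w) = η(v, w) + h η(n, v)η(n, w)` with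
`η(n, n) = 0`, the vector `v♯ = (1 + s, hn⁰n¹, hn⁰n², hn⁰n³) ≠ 0` (`s = √(1 + h'²)`,
`h' = h(n⁰)²`) has `B(v♯, w) = (h' − s)⟪v♯, w⟫` for all `w` (eigenvalue `h' − s`). [folklore] -/
theorem exists_apply_eq_mul_inner_of_nullRankOne {B : E4 →L[ℝ] E4 →L[ℝ] ℝ} {n : E4} {h : ℝ}
    (hB : ∀ v w, B v w = Minkowski.bilin v w + h * (Minkowski.bilin n v * Minkowski.bilin n w))
    (hn : Minkowski.bilin n n = 0) :
    ∃ v : E4, v ≠ 0 ∧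
      ∀ w : E4, B v w = (h * n 0 ^ 2 - √(1 + (h * n 0 ^ 2) ^ 2)) * inner ℝ v w := by
  set s := √(1 + (h * n 0 ^ 2) ^ 2)
  have hs2 : s ^ 2 = 1 + (h * n 0 ^ 2) ^ 2 := Real.sq_sqrt (by positivity)
  have hn' := sq_apply_zero_eq_of_null hn
  obtain ⟨v, hv0, hv1, hv2, hv3⟩ : ∃ v : E4, v 0 = 1 + s ∧ v 1 = h * n 0 * n 1 ∧
      v 2 = h * n 0 * n 2 ∧ v 3 = h * n 0 * n 3 :=
    ⟨WithLp.toLp 2 ![1 + s, h * n 0 * n 1, h * n 0 * n 2, h * n 0 * n 3], rfl, rfl, rfl, rfl⟩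
  refine ⟨v, fun hv ↦ ?_, fun w ↦ ?_⟩
  · exact (show (1 + s : ℝ) ≠ 0 by positivity) (hv0.symm.trans (by rw [hv]; rfl))
  · rw [hB, inner_four, minkowski_bilin_apply_four, minkowski_bilin_apply_four n v,
      minkowski_bilin_apply_four n w, hv0, hv1, hv2, hv3]
    linear_combination (w 0) * hs2 +
      (h ^ 2 * n 0 ^ 2 * w 0 - h ^ 2 * n 0 * (n 1 * w 1 + n 2 * w 2 + n 3 * w 3)) * hn'

/-- **Sharpness of the margin**: for `B(v, w) = η(v, w) + h η(n, v)η(n, w)` with `η(n, n) = 0`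
some `v ≠ 0` has `‖B(v, ·)‖ ≤ (√(1 + h'²) − h')‖v‖`, `h' = h(n⁰)²` (the eigenvector and
Cauchy–Schwarz): the margin of `B` is EXACTLY `√(1 + h'²) − h'`. [folklore] -/
theorem exists_norm_le_mul_norm_of_nullRankOne {B : E4 →L[ℝ] E4 →L[ℝ] ℝ} {n : E4} {h : ℝ}
    (hB : ∀ v w, B v w = Minkowski.bilin v w + h * (Minkowski.bilin n v * Minkowski.bilin n w))
    (hn : Minkowski.bilin n n = 0) :
    ∃ v : E4, v ≠ 0 ∧ ‖B v‖ ≤ (√(1 + (h * n 0 ^ 2) ^ 2) - h * n 0 ^ 2) * ‖v‖ := by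
  obtain ⟨v, hv, hBv⟩ := exists_apply_eq_mul_inner_of_nullRankOne hB hn
  have hμ : 0 ≤ √(1 + (h * n 0 ^ 2) ^ 2) - h * n 0 ^ 2 :=
    sub_nonneg.2 (Real.le_sqrt_of_sq_le (by linarith))
  refine ⟨v, hv, ContinuousLinearMap.opNorm_le_bound _ (by positivity) fun w ↦ ?_⟩
  rw [hBv, Real.norm_eq_abs, abs_mul, abs_sub_comm, abs_of_nonneg hμ, mul_assoc]
  exact mul_le_mul_of_nonneg_left (abs_real_inner_le_norm v w) hμ

/-- `μ(h) = √(1 + h²) − h` is antitone on `[0, ∞)` (`√(1 + b²) − √(1 + a²) ≤ b − a` for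
`0 ≤ a ≤ b`, since `a + b ≤ √(1 + a²) + √(1 + b²)`). [folklore] -/
theorem sqrt_one_add_sq_sub_le {a b : ℝ} (ha : 0 ≤ a) (hab : a ≤ b) :
    √(1 + b ^ 2) - b ≤ √(1 + a ^ 2) - a := by
  have hsa : a ≤ √(1 + a ^ 2) := Real.le_sqrt_of_sq_le (by linarith)
  have hs : √(1 + a ^ 2) ≤ √(1 + b ^ 2) := Real.sqrt_le_sqrt (by nlinarith)
  nlinarith [Real.sq_sqrt (show 0 ≤ 1 + a ^ 2 by positivity),
    Real.sq_sqrt (show 0 ≤ 1 + b ^ 2 by positivity),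
    mul_nonneg (sub_nonneg.2 hab) (add_nonneg ha (ha.trans hab)),
    mul_nonneg (sub_nonneg.2 hs) (sub_nonneg.2 hab)]

/-- `μ(h) > 1/4` for `0 ≤ h < 15/8` (`√(1 + h²) > h + 1/4 ⇔ 15/16 > h/2`). [folklore] -/
theorem quarter_lt_sqrt_one_add_sq_sub {h : ℝ} (hh : 0 ≤ h) (hlt : h < 15 / 8) :
    1 / 4 < √(1 + h ^ 2) - h := by
  rw [lt_sub_iff_add_lt, Real.lt_sqrt (by positivity)]
  nlinarith

/-- `μ(h) < 1/4` for `h > 15/8` (`√(1 + h²) < h + 1/4 ⇔ 15/16 < h/2`). [folklore] -/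
theorem sqrt_one_add_sq_sub_lt_quarter {h : ℝ} (hlt : 15 / 8 < h) : √(1 + h ^ 2) - h < 1 / 4 := by
  rw [sub_lt_iff_lt_add, Real.sqrt_lt' (by positivity)]
  nlinarith

/-- `g_{M,a}(y)(v, w) = η(v, w) + 2H(y) η(ℓ♯, v)η(ℓ♯, w)`: the Kerr–Schild form is a rank-one
deformation of `η` along `ℓ = η(ℓ♯, ·)` (Kerr–Schild 1965, §2). [cite: KerrSchild1965, §2] -/
theorem kerrBilin_apply_eq (M a : ℝ) (y v w : E4) : Kerr.bilin M a y v w = Minkowski.bilin v w +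
    2 * Kerr.scalarH M a y *
      (Minkowski.bilin (Kerr.nullVector a y) v * Minkowski.bilin (Kerr.nullVector a y) w) := by
  rw [Kerr.bilin_apply, Kerr.bilin_nullVector, Kerr.bilin_nullVector]

/-- `η(ℓ♯, ℓ♯) = ℓ(ℓ♯) = 0` wherever `r > 0` (Kerr–Schild 1965, §2). [cite: KerrSchild1965, §2] -/
theorem minkowski_nullVector_nullVector {a : ℝ} {y : E4} (hy : 0 < Kerr.radius a y) :
    Minkowski.bilin (Kerr.nullVector a y) (Kerr.nullVector a y) = 0 := by
  rw [Kerr.bilin_nullVector]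
  exact Kerr.nullCovector_nullVector hy

/-- **Exact margin of Kerr–Schild at rest, lower bound**: for `0 ≤ M` and `r(y) > 0`,
`(√(1 + (2H(y))²) − 2H(y))‖v‖ ≤ ‖g_{M,a}(y)(v, ·)‖` for all `v` (`mul_norm_le_norm_of_nullRankOne`
with `n = ℓ♯`, `(ℓ♯)⁰ = −1`, `h = 2H ≥ 0`). [cite: KerrSchild1965, §2] -/
theorem mul_norm_le_norm_kerrBilin {M a : ℝ} (hM : 0 ≤ M) {y : E4} (hy : 0 < Kerr.radius a y)
    (v : E4) : (√(1 + (2 * Kerr.scalarH M a y) ^ 2) - 2 * Kerr.scalarH M a y) * ‖v‖ ≤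
      ‖Kerr.bilin M a y v‖ := by
  have h := mul_norm_le_norm_of_nullRankOne (kerrBilin_apply_eq M a y)
    (minkowski_nullVector_nullVector hy) (mul_nonneg zero_le_two (Kerr.scalarH_nonneg hM a y)) v
  rwa [Kerr.nullVector_apply_zero, neg_one_sq, mul_one] at h

/-- **Exact margin of Kerr–Schild at rest, sharpness**: wherever `r(y) > 0` some `v ≠ 0` has
`‖g_{M,a}(y)(v, ·)‖ ≤ (√(1 + (2H(y))²) − 2H(y))‖v‖` (`exists_norm_le_mul_norm_of_nullRankOne`):
the margin of `g_{M,a}(y)` is exactly `μ(2H(y))`. [folklore] -/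
theorem exists_norm_kerrBilin_le_mul_norm (M a : ℝ) {y : E4} (hy : 0 < Kerr.radius a y) :
    ∃ v : E4, v ≠ 0 ∧ ‖Kerr.bilin M a y v‖ ≤
      (√(1 + (2 * Kerr.scalarH M a y) ^ 2) - 2 * Kerr.scalarH M a y) * ‖v‖ := by
  have h := exists_norm_le_mul_norm_of_nullRankOne (kerrBilin_apply_eq M a y)
    (minkowski_nullVector_nullVector hy)
  rwa [Kerr.nullVector_apply_zero, neg_one_sq, mul_one] at h

/-- **Radius-only margin**: for `0 ≤ M` and `r(y) > 0`, `μ(2M/r(y))‖v‖ ≤ ‖g_{M,a}(y)(v, ·)‖`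
(`2H ≤ 2M/r` by `SublinearIsFree.Slaving.abs_scalarH_le`, and `μ` is antitone). [folklore] -/
theorem mul_norm_le_norm_kerrBilin_of_radius {M a : ℝ} (hM : 0 ≤ M) {y : E4}
    (hy : 0 < Kerr.radius a y) (v : E4) :
    (√(1 + (2 * M / Kerr.radius a y) ^ 2) - 2 * M / Kerr.radius a y) * ‖v‖ ≤
      ‖Kerr.bilin M a y v‖ := by
  have h0 : 0 ≤ 2 * Kerr.scalarH M a y := mul_nonneg zero_le_two (Kerr.scalarH_nonneg hM a y)
  have hH : 2 * Kerr.scalarH M a y ≤ 2 * M / Kerr.radius a y := by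
    have h := SublinearIsFree.Slaving.abs_scalarH_le M a hy
    rw [abs_of_nonneg (Kerr.scalarH_nonneg hM a y), abs_of_nonneg hM] at h
    linarith [mul_div_assoc 2 M (Kerr.radius a y)]
  exact (mul_le_mul_of_nonneg_right (sqrt_one_add_sq_sub_le h0 hH) (norm_nonneg v)).trans
    (mul_norm_le_norm_kerrBilin hM hy v)

/-- **The exact margin beats the anchor strictly below the threshold**: for `0 < M`,
`a² < (224/225)M²` and `x ∈ Kerr.exterior M a`, `1/4 < μ(2H(x)) = √(1 + (2H(x))²) − 2H(x)`:
`√(M² − a²) > M/15`, so `r > r₊ = M + √(M² − a²) > 16M/15` and `2H ≤ 2M/r < 15/8`. [folklore] -/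
theorem quarter_lt_kerrMargin {M a : ℝ} (hM : 0 < M) (ha : a ^ 2 < 224 / 225 * M ^ 2) {x : E4}
    (hx : x ∈ Kerr.exterior M a) :
    1 / 4 < √(1 + (2 * Kerr.scalarH M a x) ^ 2) - 2 * Kerr.scalarH M a x := by
  have h := Kerr.mem_exterior.1 hx
  have hr0 : 0 < Kerr.radius a x := (le_max_right _ _).trans_lt h
  have hs : M / 15 < √(M ^ 2 - a ^ 2) := (Real.lt_sqrt (by positivity)).2 (by nlinarith)
  have h16 : 16 / 15 * M < Kerr.radius a x := by
    have hr : Kerr.rPlus M a < Kerr.radius a x := (le_max_left _ _).trans_lt h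
    unfold Kerr.rPlus at hr
    linarith
  have hH := SublinearIsFree.Slaving.abs_scalarH_le M a hr0
  rw [abs_of_pos hM, abs_of_nonneg (Kerr.scalarH_nonneg hM.le a x), le_div_iff₀ hr0] at hH
  exact quarter_lt_sqrt_one_add_sq_sub (mul_nonneg zero_le_two (Kerr.scalarH_nonneg hM.le a x))
    (by nlinarith)

/-- **Sharp at-rest soundness threshold for the `1/4` anchor** (registered structure stub of line
`Sketch`, crux stmt-FinalStateConjecture-14664, closed form). For `0 < M`, `a² < (224/225)M²`
(`|a| < 0.9978M`) and every point `x` of the Kerr exterior, `(1/4)‖v‖ ≤ ‖g_{M,a}(x)(v, ·)‖` for all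
`v ∈ E4`: the margin of the Kerr–Schild reference at rest is EXACTLY `μ(2H(x))`
(`mul_norm_le_norm_kerrBilin`, `exists_norm_kerrBilin_le_mul_norm`), `μ` is antitone with
`μ(15/8) = 1/4`, and on the exterior `2H ≤ 2M/r < 2M/r₊ ≤ 15/8` iff `r₊ ≥ 16M/15` iff
`a² ≤ (224/225)M²`. Sharpens the range `a² ≤ (8/9)M²` of `…RestAnchor` to the optimal one
(converse: `exists_norm_kerrBilin_lt_quarter_mul_norm`); with `isInvertible_add_of_norm_lt_margin`
it makes `1/4`-anchored chart values and ω-limit chart metrics of holes at rest nondegenerate on the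
whole exterior (Kerr–Schild 1965, §2; O'Neill 1983, Ch. 3, Lemma 3.4). [cite: KerrSchild1965, §2] -/
theorem quarter_mul_norm_le_norm_kerrBilin :
    ∀ {M a : ℝ}, 0 < M → a ^ 2 < 224 / 225 * M ^ 2 → ∀ {x : E4}, x ∈ Kerr.exterior M a →
      ∀ v : E4, (1 / 4 : ℝ) * ‖v‖ ≤ ‖Kerr.bilin M a x v‖ := by
  intro M a hM ha x hx v
  exact (mul_le_mul_of_nonneg_right (quarter_lt_kerrMargin hM ha hx).le (norm_nonneg v)).trans
    (mul_norm_le_norm_kerrBilin hM.le (Kerr.radius_pos_of_mem_region hx) v)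

-- the norm on `E4 →L[ℝ] E4 →L[ℝ] ℝ` needs one more level of pending instance problems
set_option maxSynthPendingDepth 3 in
/-- **Anchored chart values at rest are nondegenerate on the whole exterior, sharp range**: for
`0 < M`, `a² < (224/225)M²`, `x ∈ Kerr.exterior M a` and ANY bilinear `G` with `‖G‖ ≤ 1/4`, the
form `G + g_{M,a}(x)` is invertible (strict margin `quarter_lt_kerrMargin`; O'Neill 1983, Ch. 3,
Lemma 3.4) — sharpens `…RestAnchor` (`a² ≤ (8/9)M²`). [cite: ONeill1983, Ch. 3 Lemma 3.4] -/
theorem isInvertible_add_kerrBilin_of_norm_le_quarter_of_sq_lt {M a : ℝ} (hM : 0 < M)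
    (ha : a ^ 2 < 224 / 225 * M ^ 2) {x : E4} (hx : x ∈ Kerr.exterior M a)
    {G : E4 →L[ℝ] E4 →L[ℝ] ℝ} (hG : ‖G‖ ≤ 1 / 4) : (G + Kerr.bilin M a x).IsInvertible := by
  rw [add_comm]
  exact isInvertible_add_of_norm_lt_margin
    (mul_norm_le_norm_kerrBilin hM.le (Kerr.radius_pos_of_mem_region hx))
    (hG.trans_lt (quarter_lt_kerrMargin hM ha hx))

/-- **Near-extremal frame dragging alone defeats the absolute `1/4` anchor at the equatorial
horizon, even at rest.** For `0 < M` and `(224/225)M² < a² < M²` (`|a| > 0.9978M`, subextremal)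
some point `x` of the open Kerr exterior and `v ≠ 0` have `‖g_{M,a}(x)(v, ·)‖ < (1/4)‖v‖`: now
`r₊ < 16M/15`, and the equatorial point `x = (0, √(r² + a²), 0, 0)`, `r₊ < r < 16M/15`, has
`r(x) = r` (`Kerr.radius_sq` with `z = 0`) and `H(x) = M/r`, so `2H > 15/8`, `μ(2H) < 1/4`, and the
sharp vector of `exists_norm_kerrBilin_le_mul_norm` does it — the at-rest counterpart of
`…AnchorMargin`: beyond `a² = (224/225)M²` the absolute anchor is idle even AT REST. [folklore] -/
theorem exists_norm_kerrBilin_lt_quarter_mul_norm :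
    ∀ {M a : ℝ}, 0 < M → 224 / 225 * M ^ 2 < a ^ 2 → a ^ 2 < M ^ 2 →
      ∃ x ∈ Kerr.exterior M a, ∃ v : E4, v ≠ 0 ∧ ‖Kerr.bilin M a x v‖ < 1 / 4 * ‖v‖ := by
  intro M a hM ha hsub
  -- `M ≤ r₊ < 16M/15`; pick a radius `r₊ < r < 16M/15`
  have hsq : √(M ^ 2 - a ^ 2) < M / 15 := (Real.sqrt_lt' (by positivity)).2 (by nlinarith)
  have hrp : M ≤ Kerr.rPlus M a ∧ Kerr.rPlus M a < 16 / 15 * M := by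
    unfold Kerr.rPlus
    constructor <;> linarith [Real.sqrt_nonneg (M ^ 2 - a ^ 2)]
  obtain ⟨r, hr1, hr2⟩ := exists_between hrp.2
  have hr0 : 0 < r := hM.trans_le (hrp.1.trans hr1.le)
  -- the equatorial point `x = (0, √(r² + a²), 0, 0)` has radius `r` and `H = M/r`
  obtain ⟨x, hx1, hx2, hx3⟩ : ∃ x : E4, x 1 = √(r ^ 2 + a ^ 2) ∧ x 2 = 0 ∧ x 3 = 0 :=
    ⟨WithLp.toLp 2 ![0, √(r ^ 2 + a ^ 2), 0, 0], rfl, rfl, rfl⟩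
  have hsn : E4.spatialNorm x ^ 2 = r ^ 2 + a ^ 2 := by
    rw [E4.spatialNorm_sq, hx1, hx2, hx3, Real.sq_sqrt (by positivity)]
    ring
  have hrad : Kerr.radius a x = r := by
    have hsq2 := Kerr.radius_sq a x
    rw [hsn, hx3, show r ^ 2 + a ^ 2 - a ^ 2 = r ^ 2 by ring,
      show (r ^ 2) ^ 2 + 4 * a ^ 2 * (0 : ℝ) ^ 2 = (r ^ 2) ^ 2 by ring,
      Real.sqrt_sq (sq_nonneg r)] at hsq2
    nlinarith [Kerr.radius_nonneg a x, sq_nonneg (Kerr.radius a x - r),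
      sq_nonneg (Kerr.radius a x + r)]
  have hxmem : x ∈ Kerr.exterior M a := by
    rw [Kerr.mem_exterior, hrad]
    exact max_lt hr1 hr0
  have hH : 2 * Kerr.scalarH M a x = 2 * M / r := by
    unfold Kerr.scalarH
    rw [hrad, hx3]
    field_simp
    ring
  have hlt : 15 / 8 < 2 * Kerr.scalarH M a x := by
    rw [hH, lt_div_iff₀ hr0]
    linarith
  obtain ⟨v, hv, hle⟩ := exists_norm_kerrBilin_le_mul_norm M a (hrad ▸ hr0)
  exact ⟨x, hxmem, v, hv, hle.trans_lt
    (mul_lt_mul_of_pos_right (sqrt_one_add_sq_sub_lt_quarter hlt) (norm_pos_iff.2 hv))⟩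

/-- **The boosted Kerr–Schild form is again a null rank-one deformation of `η`**:
`g_{M,a,Λ,c}(x)(v, w) = g_{M,a}(y)(Λ⁻¹v, Λ⁻¹w) = η(v, w) + 2H(y) η(Λℓ♯, v)η(Λℓ♯, w)`,
`y = Λ⁻¹(x − c)` (`η(Λ⁻¹v, Λ⁻¹w) = η(v, w)` and `η(ℓ♯, Λ⁻¹w) = η(Λℓ♯, w)` for `Λ ∈ O(1, 3)`:
Lorentz covariance of the Kerr–Schild ansatz, Kerr–Schild 1965, §3). [cite: KerrSchild1965, §3] -/
theorem boostedKerrBilin_apply_eq (Λ : lorentzGroup) (c : E4) (M a : ℝ) (x v w : E4) :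
    boostedKerrBilin Λ c M a x v w = Minkowski.bilin v w +
      2 * Kerr.scalarH M a (poincareInv Λ c x) *
        (Minkowski.bilin ((Λ : E4 ≃L[ℝ] E4) (Kerr.nullVector a (poincareInv Λ c x))) v *
          Minkowski.bilin ((Λ : E4 ≃L[ℝ] E4) (Kerr.nullVector a (poincareInv Λ c x))) w) := by
  -- `η(u, Λ⁻¹w) = η(Λu, ΛΛ⁻¹w) = η(Λu, w)`
  have key : ∀ u w : E4, Minkowski.bilin u ((Λ : E4 ≃L[ℝ] E4).symm w) =
      Minkowski.bilin ((Λ : E4 ≃L[ℝ] E4) u) w := fun u w ↦ by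
    rw [← mem_lorentzGroup_iff.1 Λ.2 u, ContinuousLinearEquiv.apply_symm_apply]
  simp only [boostedKerrBilin_apply, kerrBilin_apply_eq, key,
    ContinuousLinearEquiv.apply_symm_apply]

/-- The boosted null vector `Λℓ♯` is `η`-null wherever `r(y) > 0` (`Λ ∈ O(1, 3)`). [folklore] -/
theorem minkowski_lorentz_nullVector {Λ : lorentzGroup} {a : ℝ} {y : E4}
    (hy : 0 < Kerr.radius a y) : Minkowski.bilin ((Λ : E4 ≃L[ℝ] E4) (Kerr.nullVector a y))
      ((Λ : E4 ≃L[ℝ] E4) (Kerr.nullVector a y)) = 0 := by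
  rw [mem_lorentzGroup_iff.1 Λ.2]
  exact minkowski_nullVector_nullVector hy

/-- **The Doppler factor**: `(Λℓ♯)⁰ = −ℓ_y(Λ⁻¹e₀)` (`ℓ_y(Λ⁻¹e₀) = η(ℓ♯, Λ⁻¹e₀) = η(Λℓ♯, e₀)` and
`η(e₀, w) = −w⁰`; O'Neill 1983, Ch. 9, pp. 233–236). [folklore] -/
theorem lorentz_nullVector_apply_zero (Λ : lorentzGroup) (a : ℝ) (y : E4) :
    (Λ : E4 ≃L[ℝ] E4) (Kerr.nullVector a y) 0 =
      -Kerr.nullCovector a y ((Λ : E4 ≃L[ℝ] E4).symm (E4.basisVector 0)) := by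
  rw [← Kerr.bilin_nullVector, ← mem_lorentzGroup_iff.1 Λ.2,
    ContinuousLinearEquiv.apply_symm_apply, Minkowski.bilin_symm,
    Minkowski.bilin_basisVector_zero_left, neg_neg]

/-- **Boosted exact margin, lower bound**: for `0 ≤ M` and a lab point `x` whose rest-frame
position `y = Λ⁻¹(x − c)` has `r(y) > 0`, `(√(1 + h²) − h)‖v‖ ≤ ‖g_{M,a,Λ,c}(x)(v, ·)‖` for all
`v`, `h = 2H(y)D²` with `D = ℓ_y(Λ⁻¹e₀)` the Doppler factor (`mul_norm_le_norm_of_nullRankOne`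
for `boostedKerrBilin_apply_eq`). Reading: the crux's `1/4` anchor is sound at `x` iff
`2H(y)D² < 15/8` — the margin is NOT Lorentz invariant (the Euclidean norm of `E4` is frame
dependent). [cite: KerrSchild1965, §3] -/
theorem mul_norm_le_norm_boostedKerrBilin_exact (Λ : lorentzGroup) (c : E4) {M : ℝ} (hM : 0 ≤ M)
    (a : ℝ) {x : E4} (hx : 0 < Kerr.radius a (poincareInv Λ c x)) (v : E4) :
    (√(1 + (2 * Kerr.scalarH M a (poincareInv Λ c x) * Kerr.nullCovector a (poincareInv Λ c x)
        ((Λ : E4 ≃L[ℝ] E4).symm (E4.basisVector 0)) ^ 2) ^ 2) -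
      2 * Kerr.scalarH M a (poincareInv Λ c x) * Kerr.nullCovector a (poincareInv Λ c x)
        ((Λ : E4 ≃L[ℝ] E4).symm (E4.basisVector 0)) ^ 2) * ‖v‖ ≤
      ‖boostedKerrBilin Λ c M a x v‖ := by
  have h := mul_norm_le_norm_of_nullRankOne (boostedKerrBilin_apply_eq Λ c M a x)
    (minkowski_lorentz_nullVector hx) (mul_nonneg zero_le_two (Kerr.scalarH_nonneg hM a _)) v
  rwa [lorentz_nullVector_apply_zero, neg_sq] at h

/-- **Boosted exact margin, sharpness**: at such `x` some `v ≠ 0` has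
`‖g_{M,a,Λ,c}(x)(v, ·)‖ ≤ (√(1 + h²) − h)‖v‖`, `h = 2H(y)D²`: the margin of the boosted reference
is EXACTLY `μ(2H(y)D²)` (`…AnchorMargin`: `D = 2`, `2H = 63/64`, `μ(63/16) = 1/8`). [folklore] -/
theorem exists_norm_boostedKerrBilin_le_mul_norm (Λ : lorentzGroup) (c : E4) (M a : ℝ) {x : E4}
    (hx : 0 < Kerr.radius a (poincareInv Λ c x)) :
    ∃ v : E4, v ≠ 0 ∧ ‖boostedKerrBilin Λ c M a x v‖ ≤
      (√(1 + (2 * Kerr.scalarH M a (poincareInv Λ c x) * Kerr.nullCovector a (poincareInv Λ c x)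
          ((Λ : E4 ≃L[ℝ] E4).symm (E4.basisVector 0)) ^ 2) ^ 2) -
        2 * Kerr.scalarH M a (poincareInv Λ c x) * Kerr.nullCovector a (poincareInv Λ c x)
          ((Λ : E4 ≃L[ℝ] E4).symm (E4.basisVector 0)) ^ 2) * ‖v‖ := by
  have h := exists_norm_le_mul_norm_of_nullRankOne (boostedKerrBilin_apply_eq Λ c M a x)
    (minkowski_lorentz_nullVector hx)
  rwa [lorentz_nullVector_apply_zero, neg_sq] at h

end Summit.FinalStateConjecture.FinalStateConjecture.Theorems.ClusterCompleteness

end
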